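import Mathlib
import Summits.ResolutionOfSingularities.ResolutionOfSingularities.Theorems.HomologicalConductorNoZenoSplitFibreGerm
import Summits.ResolutionOfSingularities.ResolutionOfSingularities.Theorems.HomologicalConductorNoZenoSplitDataThread
import HarnessLib

/-!
# D2′ PART 4c: the chart side of `Sig.L1Core` upstairs — `B_f = B[β]`, `nrm B_f = (nrm B)[β]`,
# primes `𝔮_f` over `𝔮`, and the germs `(nrm B_f)_{𝔮_f}` over `D' = (nrm B)_𝔮`

W4.4 (crux `NoZenoR`, stmt-ResolutionOfSingularities-19943), `stub_L1wCore` route (F1), descent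
step (B2) of `L1W-PREP-v2.md` §2.1 (res-L0-w44-stub-2): «`C_B := C`, `x`,
`B_B := adjoin k (D_B ∪ C·x⁻¹)`, `nrm B_B`, primes `𝔮_B` over `𝔮`, `D'_B := locPrime (nrm B_B) 𝔮_B`».
In the literal shape of `Sig.L1Core` (res-L0-w44-lead-1), with the germ `D = T_P` base-changed by
`…NoZenoSplitData` (`D_f = locPrime (splitModel D f) (splitPrime D f)`), `C_f` the image of `C` and
`x_f` the image of `x` in `K_f = K[X]/(f_K)`:

* `adjoin_chart_eq`: `k[D_f ∪ C_f·x_f⁻¹] = adjoinBeta B f_K = B[β]` for `B = k[D ∪ C·x⁻¹]`;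
* `nrm_chart_eq`: `nrm (B[β]) = (nrm B)[β]` (from `nrm_adjoinBeta_eq`, the unit condition coming
  from the separable reduction over `D`);
* `isIntegral_liftModel`, `exists_liftPrime_over`: `R[β]` is integral over `R`, so over every
  prime `𝔮` of `nrm B` there is a prime `𝔮_f` of `(nrm B)[β]`;
* for such `𝔮_f`, the germ `D'_f := locPrime ((nrm B)[β]) 𝔮_f` over `D' := (nrm B)_𝔮` satisfies the
  hypotheses (i)–(iii) of `…NoZenoSplitFibreGerm` (`chartGerm_le`, `chartGerm_frac`,
  `chartGerm_local`), hence the LOCAL-ÉTALE BUNDLE (`chartGerm_bundle`), contains `D_f`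
  (`splitGerm_subset_chartGerm`), is normal (`isIntegrallyClosed_chartGerm`), has `dim = dim D'`, is
  regular iff `D'` is, and is rational when `D'` is (`hasRationalSingularity_chartGerm`, Lipman
  (16.5) as a hypothesis).

HONEST FLAG for scheme-level consumers: `D' → D'_f` is local-étale (flat, unramified, finite
separable residue extension) but NOT finite unless `f̄` stays irreducible over `κ(D')` — the finite
map is `D' → D'[X]/(f)`, of which `D'_f` is the local ring at one of finitely many maximal ideals.
OURS (cell res-hironaka, chain W4.4); AI-written, weaker than expert review; nothing here is a
statement of the manuscript under review (Hironaka 2017); no Theses file is imported.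
-/

noncomputable section

set_option linter.dupNamespace false

open IsLocalRing Polynomial
open Summit.ResolutionOfSingularities.ResolutionOfSingularities.Theorems.NoZeno.SandwichCluster
open Parasite (locPrime isLocalRing_locPrime mem_locPrime_of_mem inv_mem_locPrime_of_not_mem)
open Thread (toSubring_le_locPrime isIntegrallyClosed_locPrime)
open Summit.ResolutionOfSingularities.ResolutionOfSingularities.Theorems.NoZeno.Birth (nrm nrm_eq_nrm)
open Summit.ResolutionOfSingularities.ResolutionOfSingularities.Theorems.SyzygyFlattening (self_le_nrm)

namespace Summit.ResolutionOfSingularities.ResolutionOfSingularities.Theorems.NoZeno.SplittingBase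

variable {k K : Type} [Field k] [Field K] [Algebra k K]

/-! ## `R[β]` is integral over `R`: primes over a given prime -/

section Integral

variable (R : Subalgebra k K) (g : K[X])

/-- `R → k[R ∪ {β}]` (inclusion along `K → K_g`). [this work] -/
def toAdjoinBeta : ↥R →+* ↥(adjoinBeta R g) :=
  ((algebraMap K (AdjoinRoot g)).comp R.val.toRingHom).codRestrict _
    fun r => Algebra.subset_adjoin (Or.inl ⟨_, r.2, rfl⟩)

/-- `toAdjoinBeta` on elements. [this work] -/
theorem coe_toAdjoinBeta (r : ↥R) :
    ((toAdjoinBeta R g r : ↥(adjoinBeta R g)) : AdjoinRoot g) = algebraMap K (AdjoinRoot g) (r : K) :=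
  rfl

/-- `k[R ∪ {β}]` as an `R`-algebra (a `def`; use with `letI`). [this work] -/
@[reducible] def adjoinBetaAlgebra : Algebra ↥R ↥(adjoinBeta R g) := (toAdjoinBeta R g).toAlgebra

variable (f : (↥R)[X]) (hg : f.map (algebraMap ↥R K) = g)

include hg in
/-- The image of `liftHom` lies in `k[R ∪ {β}]`. [this work] -/
theorem liftHom_mem_adjoinBeta (x : AdjoinRoot f) : liftHom R f g hg x ∈ adjoinBeta R g := by
  rw [← liftModel_eq_adjoinBeta R f g hg]
  exact ⟨x, rfl⟩

/-- `R[X]/(f) →ₐ[R] k[R ∪ {β}]` (`liftHom` as an `R`-algebra map). [this work] -/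
def liftAlgHomBase :
    letI := adjoinBetaAlgebra R g
    AdjoinRoot f →ₐ[↥R] ↥(adjoinBeta R g) :=
  letI := adjoinBetaAlgebra R g
  { (liftHom R f g hg).toRingHom.codRestrict (adjoinBeta R g) (liftHom_mem_adjoinBeta R g f hg) with
    commutes' := fun r => Subtype.ext (by
      change liftHom R f g hg (algebraMap ↥R (AdjoinRoot f) r) = algebraMap K (AdjoinRoot g) (r : K)
      rw [AdjoinRoot.algebraMap_eq, liftHom_of]) }

/-- `liftAlgHomBase` is onto. [this work] -/
theorem liftAlgHomBase_surjective :
    letI := adjoinBetaAlgebra R g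
    Function.Surjective (liftAlgHomBase R g f hg) := by
  rintro ⟨y, hy⟩
  rw [← liftModel_eq_adjoinBeta R f g hg] at hy
  obtain ⟨x, rfl⟩ := hy
  exact ⟨x, rfl⟩

include hg in
/-- **`k[R ∪ {β}]` is integral over `R`** (it has a monic model `f`). [this work] -/
theorem isIntegral_adjoinBeta (hf : f.Monic) :
    letI := adjoinBetaAlgebra R g
    Algebra.IsIntegral ↥R ↥(adjoinBeta R g) := by
  letI := adjoinBetaAlgebra R g
  haveI := hf.finite_adjoinRoot
  exact Algebra.IsIntegral.of_surjective (liftAlgHomBase R g f hg) (liftAlgHomBase_surjective R g f hg)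

include hg in
/-- **Lying over**: over every prime `𝔮` of `R` there is a prime `𝔮_f` of `k[R ∪ {β}]`. [this work] -/
theorem exists_adjoinBetaPrime_over (hf : f.Monic) [Fact (Irreducible g)] (𝔮 : Ideal ↥R) [𝔮.IsPrime] :
    ∃ (𝔔 : Ideal ↥(adjoinBeta R g)) (_ : 𝔔.IsPrime), ∀ r : ↥R, toAdjoinBeta R g r ∈ 𝔔 ↔ r ∈ 𝔮 := by
  letI := adjoinBetaAlgebra R g
  haveI := isIntegral_adjoinBeta R g f hg hf
  obtain ⟨Q, -, hQ, hQc⟩ := Ideal.exists_ideal_over_prime_of_isIntegral 𝔮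
    (⊥ : Ideal ↥(adjoinBeta R g)) fun r hr => by
      rw [Ideal.mem_comap, Ideal.mem_bot] at hr
      have h := congrArg (fun z : ↥(adjoinBeta R g) => (z : AdjoinRoot g)) hr
      change algebraMap K (AdjoinRoot g) (r : K) = ((0 : ↥(adjoinBeta R g)) : AdjoinRoot g) at h
      rw [ZeroMemClass.coe_zero, map_eq_zero_iff _ (algebraMap K (AdjoinRoot g)).injective] at h
      rw [show r = 0 from Subtype.ext h]
      exact 𝔮.zero_mem
  exact ⟨Q, hQ, fun r => by rw [← hQc, Ideal.mem_comap]; rfl⟩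

end Integral

/-! ## The chart ring upstairs -/

section Chart

/-- `k[k[s] ∪ t] = k[s ∪ t]`. [folklore] -/
theorem adjoin_adjoin_union {A : Type*} [CommRing A] [Algebra k A] (s t : Set A) :
    Algebra.adjoin k ((Algebra.adjoin k s : Set A) ∪ t) = Algebra.adjoin k (s ∪ t) := by
  apply le_antisymm
  · exact Algebra.adjoin_le (Set.union_subset
      (Algebra.adjoin_mono Set.subset_union_left) fun y hy => Algebra.subset_adjoin (Or.inr hy))
  · exact Algebra.adjoin_mono (Set.union_subset_union_left _ Algebra.subset_adjoin)

variable (T : Subalgebra k K) (P : Ideal ↥T) (hP : P.IsPrime) (f : (↥(locPrimeSubalgebra T P hP))[X])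
  [Fact (Irreducible (f.map (algebraMap ↥(locPrimeSubalgebra T P hP) K)))]

/-- **`B_f = B[β]`**: in `Sig.L1Core`'s shape, the upstairs chart ring
`k[D_f ∪ C_f·x_f⁻¹]` is `adjoinBeta B f_K` for the downstairs chart ring `B = k[D ∪ C·x⁻¹]`.
[this work] -/
theorem adjoin_chart_eq (hf : f.Monic) (hirr : Irreducible (f.map (residue _)))
    (hPf : (splitPrime (locPrimeSubalgebra T P hP) f).IsPrime) (C : Set K) (x : K)
    (B : Subalgebra k K)
    (hB : B = Algebra.adjoin k ((locPrime T P hP : Set K) ∪ {y : K | ∃ c ∈ C, y = c * x⁻¹})) :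
    Algebra.adjoin k ((locPrime (splitModel (locPrimeSubalgebra T P hP) f)
        (splitPrime (locPrimeSubalgebra T P hP) f) hPf : Set (AdjoinRoot (f.map (algebraMap _ K)))) ∪
      {y | ∃ c ∈ algebraMap K (AdjoinRoot (f.map (algebraMap _ K))) '' C,
        y = c * (algebraMap K (AdjoinRoot (f.map (algebraMap _ K))) x)⁻¹}) =
      adjoinBeta B (f.map (algebraMap _ K)) := by
  set φ := algebraMap K (AdjoinRoot (f.map (algebraMap ↥(locPrimeSubalgebra T P hP) K))) with hφ
  have hL : (locPrime (splitModel (locPrimeSubalgebra T P hP) f)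
        (splitPrime (locPrimeSubalgebra T P hP) f) hPf : Set (AdjoinRoot (f.map (algebraMap _ K)))) =
      Algebra.adjoin k (φ '' (locPrime T P hP : Set K) ∪ {AdjoinRoot.root _}) := by
    rw [locPrime_splitPrime_eq _ f hf hirr hPf, Subalgebra.coe_toSubring, splitModel_eq_liftModel,
      liftModel_eq_adjoinBeta]
    rfl
  have hC : {y | ∃ c ∈ φ '' C, y = c * (φ x)⁻¹} = φ '' {y : K | ∃ c ∈ C, y = c * x⁻¹} := by
    ext y
    constructor
    · rintro ⟨_, ⟨c, hc, rfl⟩, rfl⟩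
      exact ⟨c * x⁻¹, ⟨c, hc, rfl⟩, by rw [map_mul, map_inv₀]⟩
    · rintro ⟨_, ⟨c, hc, rfl⟩, rfl⟩
      exact ⟨φ c, ⟨c, hc, rfl⟩, by rw [map_mul, map_inv₀]⟩
  rw [hL, hC, adjoin_adjoin_union, Set.union_right_comm, ← Set.image_union, hB, adjoinBeta_adjoin]

/-- **`nrm B_f = (nrm B)[β]`** for the chart ring `B ⊇ D`. [this work] -/
theorem nrm_chart_eq [IsFractionRing ↥T K] (hf : f.Monic) (hsep : (f.map (residue _)).Separable)
    (B : Subalgebra k K)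
    (hDB : locPrimeSubalgebra T P hP ≤ B) :
    nrm (adjoinBeta B (f.map (algebraMap _ K))) = adjoinBeta (nrm B) (f.map (algebraMap _ K)) := by
  haveI : IsFractionRing ↥B K :=
    Literature.AlgebraicGeometry.Resolution.isFractionRing_subalgebra_of_le _ B hDB
  exact nrm_adjoinBeta_eq _ B hDB f _ rfl hf (isUnit_mk_derivative_of_separable_map hf hsep)

end Chart

/-! ## The chart germs `(k[R ∪ {β}])_{𝔮_f}` over `D' = R_𝔮` (`R = nrm B`) -/

section ChartGerm

variable (D R : Subalgebra k K) (hDR : D ≤ R) (f : (↥D)[X]) (𝔮 : Ideal ↥R) (h𝔮 : 𝔮.IsPrime)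

/-- `f` read over the new germ `R_𝔮` (as the `k`-subalgebra `locPrimeSubalgebra R 𝔮`). [this work] -/
def chartPoly : (↥(locPrimeSubalgebra R 𝔮 h𝔮))[X] :=
  f.map (Subalgebra.inclusion (hDR.trans (le_locPrimeSubalgebra R 𝔮 h𝔮))).toRingHom

/-- `chartPoly` is a model of `f_K`. [this work] -/
theorem chartPoly_map :
    (chartPoly D R hDR f 𝔮 h𝔮).map (algebraMap _ K) = f.map (algebraMap ↥D K) :=
  map_map_inclusion D f _

variable [Fact (Irreducible (f.map (algebraMap ↥D K)))]
  (𝔮f : Ideal ↥(adjoinBeta R (f.map (algebraMap ↥D K)))) (h𝔮f : 𝔮f.IsPrime)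
  (hover : ∀ r : ↥R, toAdjoinBeta R (f.map (algebraMap ↥D K)) r ∈ 𝔮f ↔ r ∈ 𝔮)

include hover in
/-- Elements of `R` off `𝔮` become units of the chart germ; elements of `𝔮` become non-units.
[this work] -/
theorem isUnit_chartGerm_algebraMap_iff (r : ↥R) :
    IsUnit (⟨algebraMap K _ (r : K), toSubring_le_locPrime _ 𝔮f h𝔮f
        (Subalgebra.mem_toSubring.mpr (toAdjoinBeta R _ r).2)⟩ :
      ↥(locPrime (adjoinBeta R (f.map (algebraMap ↥D K))) 𝔮f h𝔮f)) ↔ r ∉ 𝔮 := by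
  rw [← hover]
  exact isUnit_locPrime_iff_of_mem (T := D) (f := f) (Tf := adjoinBeta R _) (𝔓 := 𝔮f) (h𝔓 := h𝔮f)
    (toAdjoinBeta R _ r).2 _

include hover in
/-- (i) **`R_𝔮[β] ⊆ (k[R ∪ {β}])_{𝔮_f}`**. [this work] -/
theorem chartGerm_le :
    (liftModel (locPrimeSubalgebra R 𝔮 h𝔮) (chartPoly D R hDR f 𝔮 h𝔮) _ (chartPoly_map D R hDR f 𝔮 h𝔮)).toSubring ≤
      locPrime (adjoinBeta R (f.map (algebraMap ↥D K))) 𝔮f h𝔮f := by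
  intro y hy
  rw [Subalgebra.mem_toSubring, liftModel_eq_adjoinBeta] at hy
  refine Thread.adjoin_subset_of_subset _ (fun c => toSubring_le_locPrime _ 𝔮f h𝔮f
    (Subalgebra.mem_toSubring.mpr (Subalgebra.algebraMap_mem _ c))) (Set.union_subset ?_ ?_) hy
  · rintro _ ⟨d, hd, rfl⟩
    obtain ⟨a, b, ha, hb, hbq, rfl⟩ := (mem_locPrimeSubalgebra_iff R 𝔮 h𝔮).mp hd
    rw [map_mul, map_inv₀]
    exact (locPrime _ 𝔮f h𝔮f).mul_mem (mem_locPrime_of_mem _ 𝔮f h𝔮f (toAdjoinBeta R _ ⟨a, ha⟩).2)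
      (inv_mem_locPrime_of_not_mem _ 𝔮f h𝔮f (toAdjoinBeta R _ ⟨b, hb⟩).2
        (fun h => hbq ((hover ⟨b, hb⟩).mp h)))
  · rintro _ rfl
    exact mem_locPrime_of_mem _ 𝔮f h𝔮f (Algebra.subset_adjoin (Or.inr rfl))

include hover in
/-- (ii) **every element of the chart germ is `a·b⁻¹` with `a, b ∈ R_𝔮[β]`, `b` a unit.** [this work] -/
theorem chartGerm_frac (z : ↥(locPrime (adjoinBeta R (f.map (algebraMap ↥D K))) 𝔮f h𝔮f)) :
    ∃ a b : AdjoinRoot (chartPoly D R hDR f 𝔮 h𝔮),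
      IsUnit (liftToFibreGerm _ _ _ (chartPoly_map D R hDR f 𝔮 h𝔮) _ (chartGerm_le D R hDR f 𝔮 h𝔮 𝔮f h𝔮f hover) b) ∧
      (z : AdjoinRoot (f.map (algebraMap ↥D K))) * liftHom _ _ _ (chartPoly_map D R hDR f 𝔮 h𝔮) b =
        liftHom _ _ _ (chartPoly_map D R hDR f 𝔮 h𝔮) a := by
  obtain ⟨a₀, b₀, ha, hb, hbq, hz⟩ := z.2
  have hle : adjoinBeta R (f.map (algebraMap ↥D K)) ≤
      liftModel (locPrimeSubalgebra R 𝔮 h𝔮) (chartPoly D R hDR f 𝔮 h𝔮) _ (chartPoly_map D R hDR f 𝔮 h𝔮) := by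
    rw [liftModel_eq_adjoinBeta]
    exact adjoinBeta_mono (le_locPrimeSubalgebra R 𝔮 h𝔮) _
  obtain ⟨a, ha'⟩ := hle ha
  obtain ⟨b, hb'⟩ := hle hb
  refine ⟨a, b, ?_, ?_⟩
  · have hu := (isUnit_locPrime_iff_of_mem (T := D) (f := f) (Tf := adjoinBeta R _) (𝔓 := 𝔮f)
      (h𝔓 := h𝔮f) hb (mem_locPrime_of_mem _ 𝔮f h𝔮f hb)).mpr hbq
    convert hu using 1
    exact Subtype.ext hb'
  · have hb0 : b₀ ≠ 0 := Parasite.ne_zero_of_not_mem_ideal _ 𝔮f hb hbq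
    change liftHom (locPrimeSubalgebra R 𝔮 h𝔮) (chartPoly D R hDR f 𝔮 h𝔮) _
      (chartPoly_map D R hDR f 𝔮 h𝔮) a = a₀ at ha'
    change liftHom (locPrimeSubalgebra R 𝔮 h𝔮) (chartPoly D R hDR f 𝔮 h𝔮) _
      (chartPoly_map D R hDR f 𝔮 h𝔮) b = b₀ at hb'
    rw [ha', hb', hz, inv_mul_cancel_right₀ hb0]

include hover in
/-- (iii) **`R_𝔮 → (k[R ∪ {β}])_{𝔮_f}` is local.** [this work] -/
theorem chartGerm_local (d : ↥(locPrimeSubalgebra R 𝔮 h𝔮)) (hd : d ∈ maximalIdeal _) :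
    ¬ IsUnit (toFibreGerm _ _ _ (chartPoly_map D R hDR f 𝔮 h𝔮) _
      (chartGerm_le D R hDR f 𝔮 h𝔮 𝔮f h𝔮f hover) d) := by
  obtain ⟨a, b, ha, hb, hbq, hdab⟩ := (mem_locPrimeSubalgebra_iff R 𝔮 h𝔮).mp d.2
  -- `a ∈ 𝔮`, else `d` is a unit of the germ
  have haq : (⟨a, ha⟩ : ↥R) ∈ 𝔮 := by
    by_contra haq
    apply (IsLocalRing.mem_maximalIdeal _).mp hd
    have ha0 : a ≠ 0 := Parasite.ne_zero_of_not_mem_ideal R 𝔮 ha haq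
    have hb0 : b ≠ 0 := Parasite.ne_zero_of_not_mem_ideal R 𝔮 hb hbq
    have hinv : b * a⁻¹ ∈ locPrimeSubalgebra R 𝔮 h𝔮 := ⟨b, a, hb, ha, haq, rfl⟩
    refine ⟨⟨d, ⟨b * a⁻¹, hinv⟩, Subtype.ext ?_, Subtype.ext ?_⟩, rfl⟩
    · show (d : K) * (b * a⁻¹) = 1
      rw [hdab]; field_simp
    · show b * a⁻¹ * (d : K) = 1
      rw [hdab]; field_simp
  intro hunit
  -- then `a = d · b` would be a unit of the chart germ, but `a ∈ 𝔮 ⊆ 𝔮_f`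
  have hbu := (isUnit_chartGerm_algebraMap_iff D R f 𝔮 𝔮f h𝔮f hover ⟨b, hb⟩).mpr hbq
  have hau : ¬ IsUnit _ := fun h =>
    (isUnit_chartGerm_algebraMap_iff D R f 𝔮 𝔮f h𝔮f hover ⟨a, ha⟩).mp h haq
  apply hau
  have hprod : (⟨algebraMap K _ a, toSubring_le_locPrime _ 𝔮f h𝔮f
        (Subalgebra.mem_toSubring.mpr (toAdjoinBeta R _ ⟨a, ha⟩).2)⟩ :
      ↥(locPrime (adjoinBeta R (f.map (algebraMap ↥D K))) 𝔮f h𝔮f)) =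
      toFibreGerm _ _ _ (chartPoly_map D R hDR f 𝔮 h𝔮) _ (chartGerm_le D R hDR f 𝔮 h𝔮 𝔮f h𝔮f hover) d *
        ⟨algebraMap K _ b, toSubring_le_locPrime _ 𝔮f h𝔮f
          (Subalgebra.mem_toSubring.mpr (toAdjoinBeta R _ ⟨b, hb⟩).2)⟩ := by
    apply Subtype.ext
    change algebraMap K _ a = algebraMap K _ (d : K) * algebraMap K _ b
    rw [hdab, ← map_mul, inv_mul_cancel_right₀ (Parasite.ne_zero_of_not_mem_ideal R 𝔮 hb hbq)]
  rw [hprod]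
  exact hunit.mul hbu

include hover in
/-- **THE LOCAL-ÉTALE BUNDLE for the chart germ `R_𝔮 → (k[R ∪ {β}])_{𝔮_f}`** (`R` Noetherian,
`f` monic with `f'` a unit modulo `f` over `D`). [this work] -/
theorem chartGerm_bundle [IsNoetherianRing ↥R] (hf : f.Monic) (hu : IsUnit (AdjoinRoot.mk f (derivative f))) :
    letI := fibreGermAlgebra _ _ _ (chartPoly_map D R hDR f 𝔮 h𝔮) _
      (chartGerm_le D R hDR f 𝔮 h𝔮 𝔮f h𝔮f hover)
    ∃ (_ : IsLocalHom (algebraMap ↥(locPrimeSubalgebra R 𝔮 h𝔮)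
        ↥(locPrime (adjoinBeta R (f.map (algebraMap ↥D K))) 𝔮f h𝔮f))),
      IsNoetherianRing ↥(locPrime (adjoinBeta R (f.map (algebraMap ↥D K))) 𝔮f h𝔮f) ∧
      Module.Flat ↥(locPrimeSubalgebra R 𝔮 h𝔮) ↥(locPrime (adjoinBeta R (f.map (algebraMap ↥D K))) 𝔮f h𝔮f) ∧
      Algebra.FormallyUnramified ↥(locPrimeSubalgebra R 𝔮 h𝔮)
        ↥(locPrime (adjoinBeta R (f.map (algebraMap ↥D K))) 𝔮f h𝔮f) ∧
      Algebra.EssFiniteType ↥(locPrimeSubalgebra R 𝔮 h𝔮)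
        ↥(locPrime (adjoinBeta R (f.map (algebraMap ↥D K))) 𝔮f h𝔮f) ∧
      (maximalIdeal _).map (algebraMap ↥(locPrimeSubalgebra R 𝔮 h𝔮) _) =
        maximalIdeal ↥(locPrime (adjoinBeta R (f.map (algebraMap ↥D K))) 𝔮f h𝔮f) ∧
      Algebra.IsSeparable (ResidueField ↥(locPrimeSubalgebra R 𝔮 h𝔮))
        (ResidueField ↥(locPrime (adjoinBeta R (f.map (algebraMap ↥D K))) 𝔮f h𝔮f)) ∧
      Module.Finite (ResidueField ↥(locPrimeSubalgebra R 𝔮 h𝔮))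
        (ResidueField ↥(locPrime (adjoinBeta R (f.map (algebraMap ↥D K))) 𝔮f h𝔮f)) ∧
      ringKrullDim ↥(locPrime (adjoinBeta R (f.map (algebraMap ↥D K))) 𝔮f h𝔮f) =
        ringKrullDim ↥(locPrime R 𝔮 h𝔮) ∧
      (IsRegularLocalRing ↥(locPrime (adjoinBeta R (f.map (algebraMap ↥D K))) 𝔮f h𝔮f) ↔
        IsRegularLocalRing ↥(locPrime R 𝔮 h𝔮)) := by
  have hu' := isUnit_mk_derivative_map
    (Subalgebra.inclusion (hDR.trans (le_locPrimeSubalgebra R 𝔮 h𝔮))).toRingHom hu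
  have hsep : ((chartPoly D R hDR f 𝔮 h𝔮).map (residue _)).Separable := by
    rw [← ResidueField.algebraMap_eq]
    exact separable_map_of_isUnit_mk_derivative hu'
  exact fibreGerm_bundle _ _ _ (chartPoly_map D R hDR f 𝔮 h𝔮) _ (chartGerm_le D R hDR f 𝔮 h𝔮 𝔮f h𝔮f hover)
    (chartGerm_frac D R hDR f 𝔮 h𝔮 𝔮f h𝔮f hover) (chartGerm_local D R hDR f 𝔮 h𝔮 𝔮f h𝔮f hover)
    (hf.map _) hsep

end ChartGerm

end Summit.ResolutionOfSingularities.ResolutionOfSingularities.Theorems.NoZeno.SplittingBase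

end
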